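import Summits.QuantumFields.YangMills.Theorems.BalabanUVNodesN15KingModelConstraintTerm
import Summits.QuantumFields.YangMills.Theorems.BalabanUVNodesN15KingModelJetLettersColour
import HarnessLib

/-!
# N15 (NE2), King-model rung — THE CONSTRAINT TERM `T = a_K·Q*Q·A₀⁻¹`, part 2∕2: ★★ ITS CELL-OSCILLATION ROW `(T′ ⊗ 1)∘𝔇(M_{c′}, M_{blockAvg c′}) ≤
# C·r·((K+2)∕L^K)·e^{−δ|y−y′|_M}` (m-uniform, NO letter on `∇c′`), IN dag-n15-a III-B's 1-FORM CURRENCY — the one new row behind «ENTRY 3 (the COVARIANT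
# Laplacian) OF THE FIRST-ORDER DRESSED KING JET IS LIVE UNDER THE (3.35) PAIR ALONE» (the letters of `T` follow in part 3 `…KingModelConstraintLetters`)

WHY (cell `pub-ymgap`, seat `pub-ymgap-dag-n15-d`, R134 N15 NE2 s3 «King-model rung», generation 21; ARCHITECTURE NOTE INBOX l.42576, dag-n15-a g25
«K-D (go)» INBOX l.42614).  In the first-order dressed model `X = G + GVX` (`G = A₀⁻¹`, `V = M_c + Σ_μ M_{a_μ}N∇_μ`) the covariant fourth (3.42) entry is
`N²Δ_V X = m²X + T(1 + VX) − 1`, `T = a_K·Q*Q·A₀⁻¹` (part 1 `constraint_eq_id_add_kingLapOp_sub`), so `𝔇(N′²Δ′_{V′}X′, N²Δ_{V̄}X̄) = m²𝔇₀ + 𝔇(T′,T̄)∘(1 +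
V̄X̄) + T′∘(M_{c′}𝔇₀ + Σ_μ M_{a′_μ}𝔇₁^μ) + T′∘𝔇(M_{c′},M_{c̄})∘X̄ + Σ_μ T′∘𝔇(M_{a′_μ},M_{ā_μ})∘Ȳ_μ`: jet defects (dag-n15-a K-B), the letters of `T`
(part 3), and the sandwiched rows `T′∘𝔇(M_{w′}, M_{blockAvg w′})` — ★★ §2 here, small WITHOUT a fit letter: `T′ = Q′*Q′∘T′ = Q′*Q′∘(1 − Σ_μ
N′(s_μ⁻¹ − 1)∘D′_μ − m²G′)` (part 1), `Q′*Q′∘𝔇M = 0` exactly (part 1 ★ `tensorId_blockMean_comp_idef_mulOp_blockAvg`), `Q′*Q′∘N′(s_μ⁻¹ − 1)` = two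
face means (part 1 ★ `abs_blockMean_bdiff_apply_le`), `D′_μ∘𝔇M` = this seat's FILE 60 ★ `CellOsc.hasMaj_kingDOp_comp_idef_mulOp_blockAvg`
(`C·r·((K+2)∕L^K)`, m-uniform), `G′∘𝔇M` = dag-n15-a K-A `hasMaj_tensorId_kingGOp_comp_idef_mulOp_blockAvg` (`β·r·(L^K)⁻¹`).

WHAT (0 `sorry`, 0 `def`, standard axioms; ns `Summit.QuantumFields.YangMills.BalabanUVNodes.N15.KingModel.Constraint`; `T` is written out as
`tensorId (Fin (d+1)) (aK a L (K+n) • (mulVecLin (blockProj (L^nL^K) M) ∘ₗ kingGOp L a m² (K+n) (L^nL^K) M))`).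
* §1 dictionary ∕ lifts: `tensorId_comp_eq`, `hasMaj_fsum` (finite sums of majorants), `symbOp_bdiff_eq_tensorId` (`ρ(N(s_κ⁻¹ − 1)) = N(s_κ⁻¹ − 1) ⊗ 1`),
  `tensorId_kingLapOp_eq_neg_sum` (`(N²ΔA₀⁻¹) ⊗ 1 = −Σ_μ ρ(N(s_μ⁻¹−1)) ∘ (D_μ ⊗ 1)`), `tensorId_constraint_eq` (`T ⊗ 1 = 1 + (N²ΔA₀⁻¹) ⊗ 1 − m²(A₀⁻¹ ⊗ 1)`),
  `tensorId_blockMean_comp_constraint` (`(Q*Q ⊗ 1)∘(T ⊗ 1) = T ⊗ 1`), `hasMaj_tensorId_blockMean` (`Q*Q ⊗ 1 ≤ 𝟙[y = y′]`), ★ `hasMaj_tensorId_blockMean_comp_bdiff`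
  (the face lemma as a block majorant: `≤ 2·𝟙[y″ = y] + 𝟙[y″ = y − e_κ]`), `tensorId_smul_eq`, `hasMaj_smul_ofBlocks`.
* §2 `constraintRow_arith` (constants), ★★ `hasMaj_kingQOp_comp_idef_mulOp_blockAvg`: `∃ C δ > 0 ∀ K ≥ 1 ∀ n e ∀ M = 2L^e ∀ 0 < m² ≤ m₀² ∀ |c′| ≤ r`,
  `HasMaj (blkFine L K M) (blockOf (L^nL^K) M ∘ fst) ((T′ ⊗ 1) ∘ₗ idef (pull kingPrV) (pull kingPrV) (mulOp c′) (mulOp (blockAvg kingPrV c′))) (C·r·((K+2)∕L^K)·e^{−δ|y−y′|_M})`.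
HONEST FRAMING ∕ LIMITS.  Count-neutral kernel ∕ lattice bookkeeping on King's `A = 0` MODEL (template literature — [King1986] (2.13)–(2.17) p. 653,
(4.1)–(4.5) p. 670, (4.36) p. 674, p. 664 (pairing)), NOT Bałaban's covariant `G(U)`; [Balaban1985BackgroundPropagators] (3.35) p. 396, (3.42) p. 397,
(3.52) p. 400, (3.62)–(3.65) p. 402 cited as the MECHANISM of the dressed pair only; the ENTRY-3 KNIT itself (K-D) is dag-n15-a's, not in this file.
NE2⁺ is NOT PRINTED and NOT proved here; N15 is NOT discharged; K3⁸ OPEN; counts of record UNMOVED (typed 28∕28 · discharged 5∕27 · A 5∕28); one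
finite torus at fixed spacings per index — NOT ℝ⁴ ∕ infinite volume ∕ OS ∕ mass gap ∕ Clay.  `--kind proof --supports stmt-QuantumFields-27366 --as helper`.
-/

noncomputable section

open scoped BigOperators
open Finset Matrix

namespace Summit.QuantumFields.YangMills.BalabanUVNodes.N15.KingModel.Constraint

open Literature.MathematicalPhysics.QuantumFieldTheory.Balaban1983to89
open Literature.MathematicalPhysics.QuantumFieldTheory.Balaban1983to89.B11SectG (BlockNorm HasMaj hasMaj_zero hasMaj_comp)
open Literature.MathematicalPhysics.QuantumFieldTheory.Balaban1983to89.B11AxialTransport190 (abs_le_loc_ofBlocks loc_ofBlocks_le)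
open Literature.MathematicalPhysics.QuantumFieldTheory.Balaban1983to89.T4EtaRateDefect (idef idef_apply idef_add idef_sub idef_smul)
open Literature.MathematicalPhysics.QuantumFieldTheory.Balaban1983to89.T4EtaRateCoeffDefect (pull pull_apply blockAvg)
open Literature.MathematicalPhysics.QuantumFieldTheory.Balaban1983to89.B6Prop26Gluing (mulOp mulOp_apply)
open Literature.MathematicalPhysics.QuantumFieldTheory.Balaban1983to89.B5Prop11Plancherel (Tor fine unitVec)
open Literature.MathematicalPhysics.QuantumFieldTheory.King1986 (aK aK_pos aK_le)
open Literature.MathematicalPhysics.QuantumFieldTheory.King1986.Torus (blockOf blockProj tdistT tdistT_nonneg tdistT_self tdistT_symm tdistT_triangle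
  tdistT_sub_unitVec_le)
open Literature.MathematicalPhysics.QuantumFieldTheory.Balaban1983to89.B6UnitTorusCarrier (unitTorusGeo)
open Summit.QuantumFields.YangMills.BalabanUVNodes.N15.VectorPiece (kingPr kingPrV kingPrV_eq blkFine tensorId tensorId_apply hasMaj_tensorId)
open Summit.QuantumFields.YangMills.BalabanUVNodes.N15.TwoGrid (symbOp sD sTinv symbOp_sD_apply symbOp_sTinv_apply)
open Summit.QuantumFields.YangMills.BalabanUVNodes.N15.TwoGrid.KingJet (symbOp_sD_comp_tensorId_kingGOp hasMaj_tensorId_kingGOp_coarse hasMaj_tensorId_kingGOp_fine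
  hasMaj_idef_tensorId_kingGOp hasMaj_idef_tensorId_kingLapOp hasMaj_tensorId_kingGOp_comp_idef_mulOp_blockAvg hasMaj_weaken hasMaj_weaken₂)
open Summit.QuantumFields.YangMills.BalabanUVNodes.N15KingModelRung.Curved (kingGOp kingDOp kingLapOp kingGOp_apply kingDOp_apply kingLapOp_apply)
open Summit.QuantumFields.YangMills.BalabanUVNodes.N15.KingModel.CellOsc (hasMaj_kingDOp_comp_idef_mulOp_blockAvg)

variable {d : ℕ} (L : ℕ) [NeZero L]

/-! ## §1 Dictionary and lifts -/

section Dictionary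

variable (M : Fin (d + 1) → ℕ) [∀ μ, NeZero (M μ)]

omit [NeZero L] [∀ μ, NeZero (M μ)] in
/-- `(A ⊗ 1) ∘ (B ⊗ 1) = (A∘B) ⊗ 1`. [folklore] -/
theorem tensorId_comp_eq {X X₂ X₃ : Type} (A : (X₂ → ℝ) →ₗ[ℝ] (X₃ → ℝ)) (B : (X → ℝ) →ₗ[ℝ] (X₂ → ℝ)) :
    tensorId (Fin (d + 1)) A ∘ₗ tensorId (Fin (d + 1)) B = tensorId (Fin (d + 1)) (A ∘ₗ B) :=
  LinearMap.ext fun _ => rfl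

omit [NeZero L] [∀ μ, NeZero (M μ)] in
/-- `(c·A) ⊗ 1 = c·(A ⊗ 1)`. [folklore] -/
theorem tensorId_smul_eq {X X₂ : Type} (c : ℝ) (A : (X → ℝ) →ₗ[ℝ] (X₂ → ℝ)) :
    tensorId (Fin (d + 1)) (c • A) = c • tensorId (Fin (d + 1)) A :=
  LinearMap.ext fun _ => funext fun _ => rfl

omit [NeZero L] in
/-- A nonnegative scalar multiple of an operator has the scaled block majorant (sharp block sizes). [folklore] -/
theorem hasMaj_smul_ofBlocks {X₁ X₂ : Type} [Fintype X₁] [Fintype X₂] {K : ℕ} {blk₁ : X₁ → Tor M} {blk₂ : X₂ → Tor M}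
    {T : (X₁ → ℝ) →ₗ[ℝ] (X₂ → ℝ)} {Kf : Tor M → Tor M → ℝ}
    (h : HasMaj (BlockNorm.ofBlocks (unitTorusGeo L K M) blk₁) (BlockNorm.ofBlocks (unitTorusGeo L K M) blk₂) T Kf) {c : ℝ} (hc : 0 ≤ c) :
    HasMaj (BlockNorm.ofBlocks (unitTorusGeo L K M) blk₁) (BlockNorm.ofBlocks (unitTorusGeo L K M) blk₂) (c • T) (fun y y' => c * Kf y y') := by
  intro y' f hf y
  dsimp only
  have h1 := h y' f hf y
  have hl0 := (BlockNorm.ofBlocks (unitTorusGeo L K M) blk₂).loc_nonneg y (T f)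
  rw [LinearMap.smul_apply, mul_assoc]
  refine (loc_ofBlocks_le (g := unitTorusGeo L K M) blk₂ _ (mul_nonneg hc hl0) fun p hp => ?_).trans (mul_le_mul_of_nonneg_left h1 hc)
  rw [Pi.smul_apply, smul_eq_mul, abs_mul, abs_of_nonneg hc]
  exact mul_le_mul_of_nonneg_left (abs_le_loc_ofBlocks (g := unitTorusGeo L K M) blk₂ _ hp) hc

omit [NeZero L] [∀ μ, NeZero (M μ)] in
/-- Block majorants of a finite sum of operators add up. [cite: Balaban1984PropagatorsII, p.232 («a summation preserves it also»)] -/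
theorem hasMaj_fsum {ι : Type} {g : B6.Geometry} {F₁ F₂ : Type} [AddCommGroup F₁] [Module ℝ F₁] [AddCommGroup F₂] [Module ℝ F₂]
    {b₁ : BlockNorm g F₁} {b₂ : BlockNorm g F₂} (s : Finset ι) (T : ι → F₁ →ₗ[ℝ] F₂) (K : ι → g.Site → g.Site → ℝ)
    (h : ∀ i, HasMaj b₁ b₂ (T i) (K i)) : HasMaj b₁ b₂ (∑ i ∈ s, T i) (fun y y' => ∑ i ∈ s, K i y y') := by
  classical
  induction s using Finset.induction_on with
  | empty => simpa using hasMaj_zero b₁ b₂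
  | insert i s hi ih =>
      have := (h i).add ih
      simpa [Finset.sum_insert hi] using this

omit [NeZero L] [∀ μ, NeZero (M μ)] in
/-- `ρ(N(s_κ⁻¹ − 1)) = N(s_κ⁻¹ − 1) ⊗ 1`: the 1-form adjoint-difference symbol IS the lift of the scalar scaled backward difference. [folklore]
[cite: Balaban1985BackgroundPropagators, (3.42) p.397 (third entry: shape)] -/
theorem symbOp_bdiff_eq_tensorId (N : ℕ) [NeZero N] (κ : Fin (d + 1)) :
    symbOp M N (((N : ℕ) : ℝ) • (sTinv M N κ - 1))
      = tensorId (Fin (d + 1)) (((N : ℝ) • (pull (fun y : Tor (fine N M) => y - unitVec (fine N M) κ) - LinearMap.id))) := by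
  refine LinearMap.ext fun f => funext fun p => ?_
  rw [map_smul, map_sub, map_one, LinearMap.smul_apply, LinearMap.sub_apply, Pi.smul_apply, Pi.sub_apply, smul_eq_mul, symbOp_sTinv_apply,
    tensorId_apply, bdiff_apply]
  rfl

omit [NeZero L] in
/-- `(N²ΔA₀⁻¹) ⊗ 1 = −Σ_μ ρ(N(s_μ⁻¹ − 1)) ∘ ((N∇_μA₀⁻¹) ⊗ 1)` (part 1 `kingLapOp_eq_neg_sum_bdiff_comp_kingDOp`, lifted). [cite: King1986, (4.1) p.670 (Δ^η)] -/
theorem tensorId_kingLapOp_eq_neg_sum (a msq : ℝ) (K N : ℕ) [NeZero N] :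
    tensorId (Fin (d + 1)) (kingLapOp L a msq K N M)
      = -∑ μ : Fin (d + 1), symbOp M N (((N : ℕ) : ℝ) • (sTinv M N μ - 1)) ∘ₗ tensorId (Fin (d + 1)) (kingDOp L a msq K N M μ) := by
  refine LinearMap.ext fun f => funext fun p => ?_
  rw [tensorId_apply, kingLapOp_eq_neg_sum_bdiff_comp_kingDOp]
  simp only [LinearMap.neg_apply, Pi.neg_apply, LinearMap.coe_sum, Finset.sum_apply, LinearMap.coe_comp, Function.comp_apply, symbOp_bdiff_eq_tensorId,
    tensorId_apply, bdiff_apply]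

omit [NeZero L] in
/-- `T ⊗ 1 = 1 + (N²ΔA₀⁻¹) ⊗ 1 − m²·(A₀⁻¹ ⊗ 1)` (part 1 ★ `constraint_eq_id_add_kingLapOp_sub`, lifted). [cite: King1986, (4.1)–(4.5) p.670] -/
theorem tensorId_constraint_eq (hL : 2 ≤ L) {a : ℝ} (ha : 0 < a) {K : ℕ} (hK : 1 ≤ K) {msq : ℝ} (hmsq : 0 < msq) (N : ℕ) [NeZero N] :
    tensorId (Fin (d + 1)) (aK a L K • (Matrix.mulVecLin (blockProj N M) ∘ₗ kingGOp L a msq K N M))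
      = LinearMap.id + tensorId (Fin (d + 1)) (kingLapOp L a msq K N M) - msq • tensorId (Fin (d + 1)) (kingGOp L a msq K N M) := by
  rw [constraint_eq_id_add_kingLapOp_sub N M hL ha hK hmsq]
  refine LinearMap.ext fun f => funext fun p => ?_
  simp only [tensorId_apply, LinearMap.sub_apply, LinearMap.add_apply, LinearMap.smul_apply, LinearMap.id_coe, id_eq, Pi.add_apply, Pi.sub_apply,
    Pi.smul_apply, smul_eq_mul]

omit [NeZero L] in
/-- `(Q*Q ⊗ 1) ∘ (T ⊗ 1) = T ⊗ 1` (part 1 `blockMean_comp_constraint`, lifted). [cite: King1986, (4.36) p.674] -/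
theorem tensorId_blockMean_comp_constraint (a msq : ℝ) (K N : ℕ) [NeZero N] :
    tensorId (Fin (d + 1)) (Matrix.mulVecLin (blockProj N M)) ∘ₗ tensorId (Fin (d + 1)) (aK a L K • (Matrix.mulVecLin (blockProj N M) ∘ₗ kingGOp L a msq K N M))
      = tensorId (Fin (d + 1)) (aK a L K • (Matrix.mulVecLin (blockProj N M) ∘ₗ kingGOp L a msq K N M)) := by
  rw [tensorId_comp_eq, blockMean_comp_constraint]

omit [NeZero L] in
/-- **`Q*Q ⊗ 1 ≤ 𝟙[y = y′]`**: the block mean sees only its own unit block (part 1 `abs_blockMean_apply_le`). [cite: King1986, (4.36) p.674] -/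
theorem hasMaj_tensorId_blockMean (K N : ℕ) [NeZero N] :
    HasMaj (BlockNorm.ofBlocks (unitTorusGeo L K M) (fun i : Tor (fine N M) × Fin (d + 1) => blockOf N M i.1))
      (BlockNorm.ofBlocks (unitTorusGeo L K M) (fun i : Tor (fine N M) × Fin (d + 1) => blockOf N M i.1))
      (tensorId (Fin (d + 1)) (Matrix.mulVecLin (blockProj N M))) (fun y y' => if y = y' then 1 else 0) := by
  intro y' f hf y
  dsimp only
  have hL0 := (BlockNorm.ofBlocks (unitTorusGeo L K M) (fun i : Tor (fine N M) × Fin (d + 1) => blockOf N M i.1)).loc_nonneg y' f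
  have hi : 0 ≤ (if y = y' then (1 : ℝ) else 0) := by split_ifs <;> norm_num
  refine loc_ofBlocks_le (g := unitTorusGeo L K M) _ _ (mul_nonneg hi hL0) fun p hp => ?_
  rw [tensorId_apply]
  refine abs_blockMean_apply_le N M _ _ fun z hz => ?_
  by_cases hy : y = y'
  · rw [if_pos hy, one_mul]
    exact abs_le_loc_ofBlocks (g := unitTorusGeo L K M) (fun i : Tor (fine N M) × Fin (d + 1) => blockOf N M i.1) f (x' := (z, p.2))
      (by rw [← hy, ← hp]; exact hz)
  · rw [if_neg hy, zero_mul, hf (z, p.2) (by show blockOf N M z ≠ y'; rw [hz, hp]; exact hy), abs_zero]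

omit [NeZero L] in
/-- ★ **THE FACE LEMMA AS A BLOCK MAJORANT**: `(Q*Q ⊗ 1)∘ρ(N(s_κ⁻¹ − 1)) ≤ 2·𝟙[y″ = y] + 𝟙[y″ = y − e_κ]` between the fine unit blocks — a block mean of a scaled
backward difference of a field localised in block `y″` lives on `y″` and on `y″ + e_κ`, with size at most two resp. one face mean (part 1 ★
`abs_blockMean_bdiff_apply_le`). [cite: King1986, (4.36) p.674, p.664 (blocks B^k(x))] -/
theorem hasMaj_tensorId_blockMean_comp_bdiff (K N : ℕ) [NeZero N] (κ : Fin (d + 1)) :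
    HasMaj (BlockNorm.ofBlocks (unitTorusGeo L K M) (fun i : Tor (fine N M) × Fin (d + 1) => blockOf N M i.1))
      (BlockNorm.ofBlocks (unitTorusGeo L K M) (fun i : Tor (fine N M) × Fin (d + 1) => blockOf N M i.1))
      (tensorId (Fin (d + 1)) (Matrix.mulVecLin (blockProj N M)) ∘ₗ symbOp M N (((N : ℕ) : ℝ) • (sTinv M N κ - 1)))
      (fun y y'' => 2 * (if y'' = y then 1 else 0) + (if y'' = y - unitVec M κ then 1 else 0)) := by
  intro y'' f hf y
  dsimp only
  set S := (BlockNorm.ofBlocks (unitTorusGeo L K M) (fun i : Tor (fine N M) × Fin (d + 1) => blockOf N M i.1)).loc y'' f with hS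
  have hS0 : 0 ≤ S := (BlockNorm.ofBlocks (unitTorusGeo L K M) (fun i : Tor (fine N M) × Fin (d + 1) => blockOf N M i.1)).loc_nonneg y'' f
  have hi1 : 0 ≤ (if y'' = y then (1 : ℝ) else 0) := by split_ifs <;> norm_num
  have hi2 : 0 ≤ (if y'' = y - unitVec M κ then (1 : ℝ) else 0) := by split_ifs <;> norm_num
  refine loc_ofBlocks_le (g := unitTorusGeo L K M) _ _ (mul_nonneg (by linarith) hS0) fun p hp => ?_
  rw [symbOp_bdiff_eq_tensorId, tensorId_comp_eq, tensorId_apply, LinearMap.comp_apply]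
  -- the `p.2`-slice of `f` is localised in the block `y″` and bounded by `S`
  have hloc : ∀ z : Tor (fine N M), blockOf N M z ≠ y'' → f (z, p.2) = 0 := fun z hz => hf (z, p.2) hz
  have hb : ∀ z : Tor (fine N M), |f (z, p.2)| ≤ S := fun z => by
    by_cases hz : blockOf N M z = y''
    · exact abs_le_loc_ofBlocks (g := unitTorusGeo L K M) (fun i : Tor (fine N M) × Fin (d + 1) => blockOf N M i.1) f (x' := (z, p.2)) hz
    · rw [hloc z hz, abs_zero]; exact hS0
  have h := abs_blockMean_bdiff_apply_le N M (v := fun x => f (x, p.2)) hS0 hloc hb κ p.1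
  rw [hp] at h
  exact h

end Dictionary

/-! ## §2 ★★ The cell-oscillation row of the constraint term, uniform in the refinement -/

section Row

/-- The bookkeeping of ★★'s constants: `(d+1)` Laplacian rows at rate `δ₁` plus the mass row at rate `δ₂` under one `C·r·((K+2)∕L^K)·e^{−min(δ₁,δ₂)t}`. [folklore] -/
theorem constraintRow_arith (d K : ℕ) {L : ℕ} (hL : 2 ≤ L) {C₁ β₂ δ₁ δ₂ r msq m0sq t : ℝ} (hC₁ : 0 < C₁) (hβ₂ : 0 < β₂) (hr : 0 ≤ r)
    (hcap : msq ≤ m0sq) (hm0 : 0 ≤ m0sq) (ht : 0 ≤ t) :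
    ∑ _μ : Fin (d + 1), (2 + Real.exp δ₁) * C₁ * r * ((((K : ℕ) : ℝ) + 2) / (L : ℝ) ^ K) * Real.exp (-(δ₁ * t))
        + msq * (β₂ * r * (((L ^ K : ℕ) : ℝ))⁻¹ * Real.exp (-(δ₂ * t)))
      ≤ (((d : ℝ) + 1) * (2 + Real.exp δ₁) * C₁ + m0sq * β₂ + 1) * r * ((((K : ℕ) : ℝ) + 2) / (L : ℝ) ^ K) * Real.exp (-(min δ₁ δ₂ * t)) := by
  have hL0 : (0 : ℝ) < (L : ℝ) := by exact_mod_cast (show 0 < L by omega)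
  have hLK : (0 : ℝ) < (L : ℝ) ^ K := pow_pos hL0 K
  have hrate0 : 0 ≤ (((K : ℕ) : ℝ) + 2) / (L : ℝ) ^ K := by positivity
  have hE₁ : Real.exp (-(δ₁ * t)) ≤ Real.exp (-(min δ₁ δ₂ * t)) := Real.exp_le_exp.mpr (by nlinarith [min_le_left δ₁ δ₂])
  have hE₂ : Real.exp (-(δ₂ * t)) ≤ Real.exp (-(min δ₁ δ₂ * t)) := Real.exp_le_exp.mpr (by nlinarith [min_le_right δ₁ δ₂])
  have hinv : (((L ^ K : ℕ) : ℝ))⁻¹ ≤ (((K : ℕ) : ℝ) + 2) / (L : ℝ) ^ K := by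
    push_cast
    rw [inv_eq_one_div]
    exact div_le_div_of_nonneg_right (by linarith [(Nat.cast_nonneg K : (0 : ℝ) ≤ K)]) hLK.le
  set E := Real.exp (-(min δ₁ δ₂ * t)) with hE_def
  set ρ := (((K : ℕ) : ℝ) + 2) / (L : ℝ) ^ K with hρ_def
  have hsumle : ∑ _μ : Fin (d + 1), (2 + Real.exp δ₁) * C₁ * r * ρ * Real.exp (-(δ₁ * t)) ≤ ((d : ℝ) + 1) * (2 + Real.exp δ₁) * C₁ * r * ρ * E := by
    rw [Finset.sum_const, Finset.card_univ, Fintype.card_fin, nsmul_eq_mul]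
    push_cast
    have h0 : 0 ≤ ((d : ℝ) + 1) * ((2 + Real.exp δ₁) * C₁ * r * ρ) := by positivity
    have := mul_le_mul_of_nonneg_left hE₁ h0
    nlinarith [this]
  have hmass : msq * (β₂ * r * (((L ^ K : ℕ) : ℝ))⁻¹ * Real.exp (-(δ₂ * t))) ≤ m0sq * β₂ * r * ρ * E := by
    have h1 : (((L ^ K : ℕ) : ℝ))⁻¹ * Real.exp (-(δ₂ * t)) ≤ ρ * E := mul_le_mul hinv hE₂ (Real.exp_nonneg _) hrate0
    have h2 : 0 ≤ β₂ * r := mul_nonneg hβ₂.le hr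
    calc msq * (β₂ * r * (((L ^ K : ℕ) : ℝ))⁻¹ * Real.exp (-(δ₂ * t)))
        = msq * ((β₂ * r) * ((((L ^ K : ℕ) : ℝ))⁻¹ * Real.exp (-(δ₂ * t)))) := by ring
      _ ≤ m0sq * ((β₂ * r) * (ρ * E)) := mul_le_mul hcap (mul_le_mul_of_nonneg_left h1 h2) (by positivity) hm0
      _ = m0sq * β₂ * r * ρ * E := by ring
  have hrest : 0 ≤ 1 * r * ρ * E := by positivity
  calc ∑ _μ : Fin (d + 1), (2 + Real.exp δ₁) * C₁ * r * ρ * Real.exp (-(δ₁ * t)) + msq * (β₂ * r * (((L ^ K : ℕ) : ℝ))⁻¹ * Real.exp (-(δ₂ * t)))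
      ≤ ((d : ℝ) + 1) * (2 + Real.exp δ₁) * C₁ * r * ρ * E + m0sq * β₂ * r * ρ * E + 1 * r * ρ * E := by linarith
    _ = (((d : ℝ) + 1) * (2 + Real.exp δ₁) * C₁ + m0sq * β₂ + 1) * r * ρ * E := by ring

variable (d)

/-- ★★ **THE CELL-OSCILLATION ROW OF THE CONSTRAINT TERM `T = a_K·Q*Q·A₀⁻¹` OF KING's FULL `A = 0` PROPAGATOR, UNIFORM IN THE REFINEMENT, NO LETTER ON `∇c′`.**
For `d ≥ 1`, odd `L ≥ 3` (stated `Odd L`, `2 ≤ L`), `a > 0`, `m₀² ≥ 0` there are `C, δ > 0` such that for EVERY coarse level `K ≥ 1`, refinement `n`, cube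
`M_μ = 2L^e`, mass `0 < m² ≤ m₀²` and every fine multiplier `|c′| ≤ r`:
`HasMaj (King's coarse blocks) (fine unit blocks) ((T′ ⊗ 1) ∘ 𝔇_{kingPrV}(M_{c′}, M_{blockAvg c′})) (C·r·((K+2)∕L^K)·e^{−δ|y−y′|_M})`.
Proof: `T′ ⊗ 1 = (Q′*Q′ ⊗ 1)∘(1 + (N′²Δ′A₀′⁻¹) ⊗ 1 − m²(A₀′⁻¹ ⊗ 1))` (§1); the block mean kills `𝔇M` exactly (part 1 ★); the Laplacian term is
`−Σ_μ [(Q′*Q′ ⊗ 1)∘ρ(N′(s_μ⁻¹ − 1))]∘[(D′_μ ⊗ 1)∘𝔇M]` = (two face means, §1 ★) ∘ (this seat's FILE 60 ★ gradient cell-oscillation row); the mass term is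
`𝟙 ∘` (dag-n15-a K-A hGc, `β·r·(L^K)⁻¹`). [cite: King1986, (4.1)–(4.5) p.670, (4.36) p.674, p.664 (pairing), (2.13)–(2.17) p.653, (4.42) p.675; Balaban1985BackgroundPropagators, (3.35) p.396, (3.42) p.397 (fourth entry: shape), (3.52) p.400, (3.62)–(3.65) p.402 (mechanism)] -/
theorem hasMaj_kingQOp_comp_idef_mulOp_blockAvg (hd : 1 ≤ d) (hLodd : Odd L) (hL : 2 ≤ L) {a : ℝ} (ha : 0 < a) {m0sq : ℝ} (hm0 : 0 ≤ m0sq) :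
    ∃ C δ : ℝ, 0 < C ∧ 0 < δ ∧ ∀ (K : ℕ), 1 ≤ K → ∀ (n e : ℕ) (M : Fin (d + 1) → ℕ) [∀ μ, NeZero (M μ)], (∀ μ, M μ = 2 * L ^ e) →
      ∀ (msq : ℝ), 0 < msq → msq ≤ m0sq → ∀ (c' : Tor (fine (L ^ n * L ^ K) M) × Fin (d + 1) → ℝ) (r : ℝ), 0 ≤ r → (∀ z, |c' z| ≤ r) →
      HasMaj (BlockNorm.ofBlocks (unitTorusGeo L K M) (blkFine L K M))
        (BlockNorm.ofBlocks (unitTorusGeo L K M) (fun i : Tor (fine (L ^ n * L ^ K) M) × Fin (d + 1) => blockOf (L ^ n * L ^ K) M i.1))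
        (tensorId (Fin (d + 1)) (aK a L (K + n) • (Matrix.mulVecLin (blockProj (L ^ n * L ^ K) M) ∘ₗ kingGOp L a msq (K + n) (L ^ n * L ^ K) M))
          ∘ₗ idef (pull (kingPrV L K n M)) (pull (kingPrV L K n M)) (mulOp c') (mulOp (blockAvg (kingPrV L K n M) c')))
        (fun y y' => C * r * ((((K : ℕ) : ℝ) + 2) / (L : ℝ) ^ K) * Real.exp (-(δ * tdistT M y y'))) := by
  obtain ⟨C₁, δ₁, hC₁, hδ₁, HD⟩ := hasMaj_kingDOp_comp_idef_mulOp_blockAvg (d := d) L hd hLodd hL ha hm0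
  obtain ⟨β₂, δ₂, hβ₂, hδ₂, HG⟩ := hasMaj_tensorId_kingGOp_comp_idef_mulOp_blockAvg (d := d) L hLodd hL ha hm0
  set δ : ℝ := min δ₁ δ₂ with hδ_def
  have hδ : 0 < δ := lt_min hδ₁ hδ₂
  have hδle₁ : δ ≤ δ₁ := min_le_left _ _
  have hδle₂ : δ ≤ δ₂ := min_le_right _ _
  -- the constant: `(d+1)` Laplacian directions × (two face means on the block, one on the neighbour, `e^{δ₁}`) × FILE 60's, plus the mass term
  set C : ℝ := ((d : ℝ) + 1) * (2 + Real.exp δ₁) * C₁ + m0sq * β₂ + 1 with hC_def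
  have hC : 0 < C := by positivity
  refine ⟨C, δ, hC, hδ, fun K hK n e M _ hM msq hmsq hcap c' r hr hc' => ?_⟩
  -- opaque names for the six operators (no `set`: the terms are large)
  obtain ⟨BP, hBP⟩ : ∃ BP : (Tor (fine (L ^ n * L ^ K) M) × Fin (d + 1) → ℝ) →ₗ[ℝ] (Tor (fine (L ^ n * L ^ K) M) × Fin (d + 1) → ℝ),
      BP = tensorId (Fin (d + 1)) (Matrix.mulVecLin (blockProj (L ^ n * L ^ K) M)) := ⟨_, rfl⟩
  obtain ⟨Gt, hGt⟩ : ∃ Gt : (Tor (fine (L ^ n * L ^ K) M) × Fin (d + 1) → ℝ) →ₗ[ℝ] (Tor (fine (L ^ n * L ^ K) M) × Fin (d + 1) → ℝ),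
      Gt = tensorId (Fin (d + 1)) (kingGOp L a msq (K + n) (L ^ n * L ^ K) M) := ⟨_, rfl⟩
  obtain ⟨T, hT⟩ : ∃ T : (Tor (fine (L ^ n * L ^ K) M) × Fin (d + 1) → ℝ) →ₗ[ℝ] (Tor (fine (L ^ n * L ^ K) M) × Fin (d + 1) → ℝ),
      T = tensorId (Fin (d + 1)) (aK a L (K + n) • (Matrix.mulVecLin (blockProj (L ^ n * L ^ K) M) ∘ₗ kingGOp L a msq (K + n) (L ^ n * L ^ K) M)) := ⟨_, rfl⟩
  obtain ⟨DM, hDM⟩ : ∃ DM : (Tor (fine (L ^ K) M) × Fin (d + 1) → ℝ) →ₗ[ℝ] (Tor (fine (L ^ n * L ^ K) M) × Fin (d + 1) → ℝ),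
      DM = idef (pull (kingPrV L K n M)) (pull (kingPrV L K n M)) (mulOp c') (mulOp (blockAvg (kingPrV L K n M) c')) := ⟨_, rfl⟩
  obtain ⟨Bd, hBd⟩ : ∃ Bd : Fin (d + 1) → ((Tor (fine (L ^ n * L ^ K) M) × Fin (d + 1) → ℝ) →ₗ[ℝ] (Tor (fine (L ^ n * L ^ K) M) × Fin (d + 1) → ℝ)),
      Bd = fun μ => symbOp M (L ^ n * L ^ K) (((L ^ n * L ^ K : ℕ) : ℝ) • (sTinv M (L ^ n * L ^ K) μ - 1)) := ⟨_, rfl⟩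
  obtain ⟨Dt, hDt⟩ : ∃ Dt : Fin (d + 1) → ((Tor (fine (L ^ n * L ^ K) M) × Fin (d + 1) → ℝ) →ₗ[ℝ] (Tor (fine (L ^ n * L ^ K) M) × Fin (d + 1) → ℝ)),
      Dt = fun μ => symbOp M (L ^ n * L ^ K) (sD M (L ^ n * L ^ K) μ ((L ^ n * L ^ K : ℕ) : ℝ)) ∘ₗ tensorId (Fin (d + 1)) (kingGOp L a msq (K + n) (L ^ n * L ^ K) M) :=
    ⟨_, rfl⟩
  -- the operator identity `T′∘𝔇M = −Σ_μ (BP∘Bd_μ)∘(Dt_μ∘𝔇M) − m²·BP∘(Gt∘𝔇M)`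
  have hann : BP ∘ₗ DM = 0 := by rw [hBP, hDM]; exact tensorId_blockMean_comp_idef_mulOp_blockAvg K n M c'
  have hTid : T = LinearMap.id + tensorId (Fin (d + 1)) (kingLapOp L a msq (K + n) (L ^ n * L ^ K) M) - msq • Gt := by
    rw [hT, hGt]; exact tensorId_constraint_eq L M hL ha (by omega) hmsq (L ^ n * L ^ K)
  have hBT : BP ∘ₗ T = T := by rw [hBP, hT]; exact tensorId_blockMean_comp_constraint L M a msq (K + n) (L ^ n * L ^ K)
  have hLap : tensorId (Fin (d + 1)) (kingLapOp L a msq (K + n) (L ^ n * L ^ K) M) = -∑ μ : Fin (d + 1), Bd μ ∘ₗ Dt μ := by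
    rw [tensorId_kingLapOp_eq_neg_sum, hBd, hDt]
    refine congrArg Neg.neg (Finset.sum_congr rfl fun μ _ => ?_)
    dsimp only
    rw [symbOp_sD_comp_tensorId_kingGOp]
  have hop : T ∘ₗ DM = -(∑ μ : Fin (d + 1), (BP ∘ₗ Bd μ) ∘ₗ (Dt μ ∘ₗ DM)) - msq • (BP ∘ₗ (Gt ∘ₗ DM)) := by
    have hann' : ∀ g, BP (DM g) = 0 := fun g => by
      have := LinearMap.congr_fun hann g
      simpa only [LinearMap.comp_apply, LinearMap.zero_apply] using this
    refine LinearMap.ext fun g => ?_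
    have h1 : T (DM g) = BP (T (DM g)) := by
      have := LinearMap.congr_fun hBT (DM g)
      simpa only [LinearMap.comp_apply] using this.symm
    rw [LinearMap.comp_apply, h1, hTid, hLap]
    simp only [LinearMap.sub_apply, LinearMap.add_apply, LinearMap.neg_apply, LinearMap.smul_apply, LinearMap.id_coe, id_eq, LinearMap.coe_sum,
      Finset.sum_apply, LinearMap.coe_comp, Function.comp_apply, map_add, map_sub, map_neg, map_smul, map_sum, hann', zero_add]
  -- the rows
  have hface : ∀ μ : Fin (d + 1), HasMaj
      (BlockNorm.ofBlocks (unitTorusGeo L K M) (fun i : Tor (fine (L ^ n * L ^ K) M) × Fin (d + 1) => blockOf (L ^ n * L ^ K) M i.1))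
      (BlockNorm.ofBlocks (unitTorusGeo L K M) (fun i : Tor (fine (L ^ n * L ^ K) M) × Fin (d + 1) => blockOf (L ^ n * L ^ K) M i.1))
      (BP ∘ₗ Bd μ) (fun y y'' => 2 * (if y'' = y then 1 else 0) + (if y'' = y - unitVec M μ then 1 else 0)) := fun μ => by
    rw [hBP, hBd]; exact hasMaj_tensorId_blockMean_comp_bdiff L M K (L ^ n * L ^ K) μ
  have hD : ∀ μ : Fin (d + 1), HasMaj (BlockNorm.ofBlocks (unitTorusGeo L K M) (blkFine L K M))
      (BlockNorm.ofBlocks (unitTorusGeo L K M) (fun i : Tor (fine (L ^ n * L ^ K) M) × Fin (d + 1) => blockOf (L ^ n * L ^ K) M i.1))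
      (Dt μ ∘ₗ DM) (fun y y' => C₁ * r * ((((K : ℕ) : ℝ) + 2) / (L : ℝ) ^ K) * Real.exp (-(δ₁ * tdistT M y y'))) := fun μ => by
    rw [hDt, hDM]; exact HD K hK n e M hM msq hmsq hcap μ c' r hr hc'
  have hG : HasMaj (BlockNorm.ofBlocks (unitTorusGeo L K M) (blkFine L K M))
      (BlockNorm.ofBlocks (unitTorusGeo L K M) (fun i : Tor (fine (L ^ n * L ^ K) M) × Fin (d + 1) => blockOf (L ^ n * L ^ K) M i.1))
      (Gt ∘ₗ DM) (fun y y' => β₂ * r * (((L ^ K : ℕ) : ℝ))⁻¹ * Real.exp (-(δ₂ * tdistT M y y'))) := by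
    rw [hGt, hDM]; exact HG K hK n e M hM msq hmsq hcap c' r hr hc'
  have hBPm : HasMaj (BlockNorm.ofBlocks (unitTorusGeo L K M) (fun i : Tor (fine (L ^ n * L ^ K) M) × Fin (d + 1) => blockOf (L ^ n * L ^ K) M i.1))
      (BlockNorm.ofBlocks (unitTorusGeo L K M) (fun i : Tor (fine (L ^ n * L ^ K) M) × Fin (d + 1) => blockOf (L ^ n * L ^ K) M i.1))
      BP (fun y y' => if y = y' then 1 else 0) := by rw [hBP]; exact hasMaj_tensorId_blockMean L M K (L ^ n * L ^ K)
  have hκ : (BlockNorm.ofBlocks (unitTorusGeo L K M) (fun i : Tor (fine (L ^ n * L ^ K) M) × Fin (d + 1) => blockOf (L ^ n * L ^ K) M i.1)).κ = 1 := rfl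
  -- composition: the Laplacian directions
  have hLapRow : ∀ μ : Fin (d + 1), HasMaj (BlockNorm.ofBlocks (unitTorusGeo L K M) (blkFine L K M))
      (BlockNorm.ofBlocks (unitTorusGeo L K M) (fun i : Tor (fine (L ^ n * L ^ K) M) × Fin (d + 1) => blockOf (L ^ n * L ^ K) M i.1))
      ((BP ∘ₗ Bd μ) ∘ₗ (Dt μ ∘ₗ DM)) (fun y y' => (2 + Real.exp δ₁) * C₁ * r * ((((K : ℕ) : ℝ) + 2) / (L : ℝ) ^ K) * Real.exp (-(δ₁ * tdistT M y y'))) := by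
    intro μ
    have hi : ∀ y y'' : Tor M, 0 ≤ 2 * (if y'' = y then (1 : ℝ) else 0) + (if y'' = y - unitVec M μ then 1 else 0) := fun y y'' => by
      have h1 : 0 ≤ (if y'' = y then (1 : ℝ) else 0) := by split_ifs <;> norm_num
      have h2 : 0 ≤ (if y'' = y - unitVec M μ then (1 : ℝ) else 0) := by split_ifs <;> norm_num
      linarith
    refine (hasMaj_comp (hface μ) (hD μ) hi).mono fun y y' => ?_
    rw [hκ]
    have hA : 0 ≤ C₁ * r * ((((K : ℕ) : ℝ) + 2) / (L : ℝ) ^ K) := by positivity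
    -- the convolution of the two-indicator kernel with FILE 60's row: the row at `y` twice and at `y − e_μ` once
    have hsum : ∑ y'' : Tor M, (2 * (if y'' = y then (1 : ℝ) else 0) + (if y'' = y - unitVec M μ then 1 else 0))
          * (1 * (C₁ * r * ((((K : ℕ) : ℝ) + 2) / (L : ℝ) ^ K) * Real.exp (-(δ₁ * tdistT M y'' y'))))
        = 2 * (C₁ * r * ((((K : ℕ) : ℝ) + 2) / (L : ℝ) ^ K) * Real.exp (-(δ₁ * tdistT M y y')))
          + C₁ * r * ((((K : ℕ) : ℝ) + 2) / (L : ℝ) ^ K) * Real.exp (-(δ₁ * tdistT M (y - unitVec M μ) y')) := by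
      have hpt : ∀ y'' : Tor M, (2 * (if y'' = y then (1 : ℝ) else 0) + (if y'' = y - unitVec M μ then 1 else 0))
            * (1 * (C₁ * r * ((((K : ℕ) : ℝ) + 2) / (L : ℝ) ^ K) * Real.exp (-(δ₁ * tdistT M y'' y'))))
          = 2 * (if y'' = y then C₁ * r * ((((K : ℕ) : ℝ) + 2) / (L : ℝ) ^ K) * Real.exp (-(δ₁ * tdistT M y'' y')) else 0)
            + (if y'' = y - unitVec M μ then C₁ * r * ((((K : ℕ) : ℝ) + 2) / (L : ℝ) ^ K) * Real.exp (-(δ₁ * tdistT M y'' y')) else 0) := by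
        intro y''
        split_ifs <;> ring
      rw [Finset.sum_congr rfl fun y'' _ => hpt y'', Finset.sum_add_distrib, ← Finset.mul_sum]
      simp only [Finset.sum_ite_eq', Finset.mem_univ, if_true]
    rw [hsum]
    -- the neighbour's decay: `|y − e_μ − y′| ≥ |y − y′| − 1`
    have htri : tdistT M y y' - 1 ≤ tdistT M (y - unitVec M μ) y' := by
      have h1 := tdistT_triangle M y (y - unitVec M μ) y'
      have h2 := tdistT_sub_unitVec_le M y μ
      linarith
    have hexp : Real.exp (-(δ₁ * tdistT M (y - unitVec M μ) y')) ≤ Real.exp δ₁ * Real.exp (-(δ₁ * tdistT M y y')) := by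
      rw [← Real.exp_add]
      exact Real.exp_le_exp.mpr (by nlinarith [hδ₁.le])
    have hE : 0 ≤ Real.exp (-(δ₁ * tdistT M y y')) := Real.exp_nonneg _
    nlinarith [mul_le_mul_of_nonneg_left hexp hA]
  -- composition: the mass term
  have hMassRow : HasMaj (BlockNorm.ofBlocks (unitTorusGeo L K M) (blkFine L K M))
      (BlockNorm.ofBlocks (unitTorusGeo L K M) (fun i : Tor (fine (L ^ n * L ^ K) M) × Fin (d + 1) => blockOf (L ^ n * L ^ K) M i.1))
      (BP ∘ₗ (Gt ∘ₗ DM)) (fun y y' => β₂ * r * (((L ^ K : ℕ) : ℝ))⁻¹ * Real.exp (-(δ₂ * tdistT M y y'))) := by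
    have hi : ∀ y y' : Tor M, 0 ≤ (if y = y' then (1 : ℝ) else 0) := fun y y' => by split_ifs <;> norm_num
    refine (hasMaj_comp hBPm hG hi).mono fun y y' => le_of_eq ?_
    rw [hκ]
    simp only [ite_mul, one_mul, zero_mul, Finset.sum_ite_eq, Finset.mem_univ, if_true]
  -- assembling along the operator identity
  have hneg := (hasMaj_fsum (Finset.univ : Finset (Fin (d + 1))) (fun μ => (BP ∘ₗ Bd μ) ∘ₗ (Dt μ ∘ₗ DM)) _ hLapRow).neg
  have hsm := hasMaj_smul_ofBlocks L M hMassRow hmsq.le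
  rw [← hT, ← hDM, hop]
  refine (hneg.sub hsm).mono fun y y' => ?_
  exact constraintRow_arith d K hL hC₁ hβ₂ hr hcap hm0 (tdistT_nonneg M y y')

end Row

end Summit.QuantumFields.YangMills.BalabanUVNodes.N15.KingModel.Constraint

end
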